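import Summits.QuantumFields.YangMills.Theorems.BalabanUVNodesN06DirKinematicsAtPins
import Literature.MathematicalPhysics.QuantumFieldTheory.Balaban1983to89.B9WalkLettersCoordsS
import Literature.MathematicalPhysics.QuantumFieldTheory.Balaban1983to89.B9Thm31SiteGsqBoundsReg335Y

/-!
# BalabanUVNodes ∕ N06 ([B9], `Dag.B9_main`) — THE KINEMATIC CONJUNCTS OF ROWS 18 IN THE ₃ SHAPE: `h36H`'s second-order component
# `L2SecondLegs37 ∧ (G′_□ᵀ = G′_□) ∧ (Pᵗ = Pᵀ) ∧ (Cᵗ = Cᵀ) ∧ DirTranspose37` — the local-inverse symmetry DERIVED at the walk-letter pin `hGsqF`, the other two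
# transposes abstract, the three kinematic conjuncts of `N06DirKinematicsAtPins` knitted in the same binder (a 40-line adapter for the certificate editions ≥ 40)

Track A of `YM-PLAN.md` (cell `pub-ymgap`, HUMAN RULING D-0062), node **N06** = [Balaban1985BackgroundPropagators] Thms 3.1–3.15; seat `pub-ymgap-dag-n06-d`
(s2, «knit N06 at the ₁₁ record»), gen 12.  A HELPER for the stage-11 certificate editions ≥ 40 (the ₃ knit-swap edition).

WHAT.  dag-n06-w1's ₃ consumer face `B9RWSumsDefinitePinsPairMDir3Rows.rows131819_definite_geo9Y_pairM_dir₃` (p640591) reads, in `h36H`'s second-order component, the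
LEFT-Neumann-series kinematics `(∀ q', IsTransposePair ((𝔬 x).Gsq U q') ((𝔬 x).Gsq U q')) ∧ (∀ q' μ, IsTransposePair ((𝔩 x).Pt U q' μ) ((𝔩 x).P U q' μ)) ∧
(∀ q', IsTransposePair ((𝔬 x).Ct U q') ((𝔬 x).Cop U q'))` in place of the third-order schema `FactorsL2Second37Dir … p3.θ3` (off print's scale).  At the certificate's
walk-letter pin `hGsqF : (𝔬 x).Gsq U □ = gsqcoS x (trBasis N) … (parSymY) □ U` (= `GcoS … (GsqY … (parSymY) (cubeDomY x □)) U`) the FIRST is a theorem for every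
SU(N)-valued `U`: dag-n06-w1's `B9Thm31SiteGsqBoundsReg335Y.isSymmTr_GsqY_parSymY` (regime-free: the padded local inverse of the symmetric `Δ′_a(U)` sandwiched by the
symmetric cube projection) transported by this seat's `B9CoReadingCoordsTranspose.isTransposePair_GcoS_trBasis`; the (3.35) class `Reg335` makes `U` SU(N)-valued.  The other
two stay ABSTRACT slots `P₄ P₄'` (the direction letters `𝔩 x` and `(𝔬 x).Ct ∕ Cop` carry no pin in the certificate).  ★★ `h36H_of_dir_pins₃`: the member-∀ binder
`P₁ ∧ P₂ ∧ (P₃ ∧ P₄ ∧ P₄') ∧ (P₅ ∧ P₆) ∧ (P₇ ∧ P₈)` ↦ `P₁ ∧ P₂ ∧ (P₃ ∧ (G′_□ symmetric) ∧ P₄ ∧ P₄' ∧ DirTranspose37) ∧ (P₅ ∧ P₆ ∧ DirSupHolder37) ∧ (P₇ ∧ P₈ ∧ DirSup37)`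
from the pins `h𝔭 hblkS hblkYS hGpS hDS hDsS h𝔡d h𝔡s hGsqF` (the three kinematic conjuncts exactly as in `h36H_of_dir_pins`; cube index `ι := cubes`).
HONEST FRAMING.  Kernel bookkeeping; COUNT-NEUTRAL; nothing of [B9]'s estimates asserted; N06 NOT discharged.  One finite 𝕋⁴ programme at fixed `ε` — NOT continuum,
NOT OS, NOT the mass gap ∕ Clay.  0 `def`, 0 `sorry`.
-/

noncomputable section

namespace Summit.QuantumFields.YangMills.BalabanUVNodes.N06DirKinematics3AtPins

open Literature.MathematicalPhysics.QuantumFieldTheory.Balaban1983to89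
open Literature.MathematicalPhysics.QuantumFieldTheory.Balaban1983to89.Node00 (SiteY FBondY IBondY SiteOpY SiteParY etaS parSymY)
open Literature.MathematicalPhysics.QuantumFieldTheory.Balaban1983to89.Node00.OpsYLocalInverse (GsqY)
open Literature.MathematicalPhysics.QuantumFieldTheory.Balaban1983to89.B6Cover236MultiLevelBlocks (cubes)
open Literature.MathematicalPhysics.QuantumFieldTheory.Balaban1983to89.Node00.OpsYDirTranspose (dirTranspose37_memberY)
open Literature.MathematicalPhysics.QuantumFieldTheory.Balaban1983to89.B9Thm37Whole (Ops)
open Literature.MathematicalPhysics.QuantumFieldTheory.Balaban1983to89.B9Thm37Glue (IsTransposePair)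
open Literature.MathematicalPhysics.QuantumFieldTheory.Balaban1983to89.B9RWSums346SecondDiffGp (DirOps37 DirTranspose37)
open Literature.MathematicalPhysics.QuantumFieldTheory.Balaban1983to89.B9RWSums346MixedPair (DirSup37)
open Literature.MathematicalPhysics.QuantumFieldTheory.Balaban1983to89.B9RWSums344InputPair (DirSupHolder37)
open Literature.MathematicalPhysics.QuantumFieldTheory.Balaban1983to89.B9RWSums343Holder (HolderProbes)
open Literature.MathematicalPhysics.QuantumFieldTheory.Balaban1983to89.B9CoReadingCoords (coordOpK)
open Literature.MathematicalPhysics.QuantumFieldTheory.Balaban1983to89.B9CoReadingCoordsS (XSK blkSK sIK GcoS DcoS DscoS)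
open Literature.MathematicalPhysics.QuantumFieldTheory.Balaban1983to89.B9CoReadingCoordsHolder (PK)
open Literature.MathematicalPhysics.QuantumFieldTheory.Balaban1983to89.B9CoReadingCoordsHolderSAdm (holderProbesSA)
open Literature.MathematicalPhysics.QuantumFieldTheory.Balaban1983to89.B9CoReadingCoordsTranspose (TrIdx trBasis isTransposePair_GcoS_trBasis)
open Literature.MathematicalPhysics.QuantumFieldTheory.Balaban1983to89.B9Ineq349SiteComposite (cdSL cdsSL)
open Literature.MathematicalPhysics.QuantumFieldTheory.Balaban1983to89.B9DirSupAtPins (dirSup37_pins)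
open Literature.MathematicalPhysics.QuantumFieldTheory.Balaban1983to89.B9PinMembersKLevelV1 (MemberY geo9Y bg9Y)
open Literature.MathematicalPhysics.QuantumFieldTheory.Balaban1983to89.B7Prop2SpecialUnitary (specialUnitaryUnits specialUnitaryUnits_le_unitaryUnits)
open Literature.MathematicalPhysics.QuantumFieldTheory.Balaban1983to89.B9WalkLettersCoordsS (gsqcoS cubeDomY)
open Literature.MathematicalPhysics.QuantumFieldTheory.Balaban1983to89.B9Thm31SiteGsqBoundsReg335Y (isSymmTr_GsqY_parSymY)
open Summit.QuantumFields.YangMills.BalabanUVNodes.N06DirKinematicsAtPins (dirSupHolder37_pinsSA)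
open scoped Matrix.Norms.L2Operator

variable {N : ℕ}
variable {d ℓ : ℕ} {hd : 1 ≤ d + 1} {hL : Odd (ℓ + 1) ∧ 1 < ℓ + 1} {b₀ b₁ : ℝ} {Mstar : ℕ}
variable [∀ x : MemberY d ℓ hd hL b₀ b₁ Mstar, Fintype (geo9Y x).Site]

/-- ★★ **`h36H` IN THE ₃ SHAPE FROM `h36H` WITHOUT THE KINEMATIC CONJUNCTS + THE PINS** (module docstring): the local-inverse symmetry `G′_□(U)ᵀ = G′_□(U)` derived at
`hGsqF` for SU(N)-valued `U`, the slots `P₄ P₄'` (print's `Pᵗ = Pᵀ`, `Cᵗ = Cᵀ`) passed through, `DirTranspose37 ∕ DirSupHolder37 ∕ DirSup37` from the pins.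
[cite: Balaban1985BackgroundPropagators, Thm 3.11 p.416 («symmetric») + (3.79) p.406 + pp.408–410 (G′_□, left series) + p.391 + (3.8) p.392 + (3.39)–(3.40) p.397 + (3.43) p.398 + (3.35) p.396;
Balaban1984PropagatorsII, (2.37) p.229 + (2.51) p.232] -/
theorem h36H_of_dir_pins₃
    (𝔬 : ∀ x : MemberY d ℓ hd hL b₀ b₁ Mstar,
      Ops (geo9Y x) (bg9Y (Matrix (Fin N) (Fin N) ℂ) (specialUnitaryUnits (Fin N)) x) (XSK (TrIdx N) x.toKIdx) (XSK (TrIdx N) x.toKIdx)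
        ↥(cubes x.toKIdx.D.toDomains))
    (𝔡 : ∀ x : MemberY d ℓ hd hL b₀ b₁ Mstar, DirOps37 (𝔬 x) (Fin (d + 1)))
    (𝔭 : ∀ x : MemberY d ℓ hd hL b₀ b₁ Mstar, HolderProbes (geo9Y x) (bg9Y (Matrix (Fin N) (Fin N) ℂ) (specialUnitaryUnits (Fin N)) x) (XSK (TrIdx N) x.toKIdx)
      (XSK (TrIdx N) x.toKIdx) (PK (SiteY x.toKIdx) (Fin (d + 1)) (TrIdx N)) (PK (SiteY x.toKIdx) (Fin (d + 1)) (TrIdx N)))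
    {bI : ∀ x : MemberY d ℓ hd hL b₀ b₁ Mstar, FBondY x.toKIdx → IBondY x.toKIdx}
    (Gp : ∀ x : MemberY d ℓ hd hL b₀ b₁ Mstar, SiteOpY (Matrix (Fin N) (Fin N) ℂ) x.toKIdx)
    (parS : ∀ x : MemberY d ℓ hd hL b₀ b₁ Mstar, SiteParY (Matrix (Fin N) (Fin N) ℂ) x.toKIdx)
    (h𝔭 : ∀ x : MemberY d ℓ hd hL b₀ b₁ Mstar,
      𝔭 x = holderProbesSA x.toKIdx (trBasis N) (bg9Y (Matrix (Fin N) (Fin N) ℂ) (specialUnitaryUnits (Fin N)) x) (fun U => U) (parS x) (bI x))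
    (hblkS : ∀ x : MemberY d ℓ hd hL b₀ b₁ Mstar, (𝔬 x).blk = blkSK x.toKIdx (sIK x.toKIdx (bI x)))
    (hblkYS : ∀ x : MemberY d ℓ hd hL b₀ b₁ Mstar, (𝔬 x).blkY = blkSK x.toKIdx (sIK x.toKIdx (bI x)))
    (hGpS : ∀ (x : MemberY d ℓ hd hL b₀ b₁ Mstar) U,
      (𝔬 x).Gp U = GcoS x.toKIdx (trBasis N) (bg9Y (Matrix (Fin N) (Fin N) ℂ) (specialUnitaryUnits (Fin N)) x) (fun U => U) (Gp x) U)
    (hDS : ∀ (x : MemberY d ℓ hd hL b₀ b₁ Mstar) U, (𝔬 x).D U = DcoS x.toKIdx (trBasis N) (bg9Y (Matrix (Fin N) (Fin N) ℂ) (specialUnitaryUnits (Fin N)) x) (fun U => U) U)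
    (hDsS : ∀ (x : MemberY d ℓ hd hL b₀ b₁ Mstar) U,
      (𝔬 x).Dstar U = DscoS x.toKIdx (trBasis N) (bg9Y (Matrix (Fin N) (Fin N) ℂ) (specialUnitaryUnits (Fin N)) x) (fun U => U) U)
    (h𝔡d : ∀ (x : MemberY d ℓ hd hL b₀ b₁ Mstar) (U : (bg9Y (Matrix (Fin N) (Fin N) ℂ) (specialUnitaryUnits (Fin N)) x).Cfg),
      (𝔡 x).Dd U = fun μ => (etaS x.toKIdx)⁻¹ • coordOpK (trBasis N) (fun _ : Fin (d + 1) => (cdSL x.toKIdx U μ).restrictScalars ℝ))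
    (h𝔡s : ∀ (x : MemberY d ℓ hd hL b₀ b₁ Mstar) (U : (bg9Y (Matrix (Fin N) (Fin N) ℂ) (specialUnitaryUnits (Fin N)) x).Cfg),
      (𝔡 x).Dsd U = fun μ => (etaS x.toKIdx)⁻¹ • coordOpK (trBasis N) (fun _ : Fin (d + 1) => (cdsSL x.toKIdx U μ).restrictScalars ℝ))
    (hGsqF : ∀ (x : MemberY d ℓ hd hL b₀ b₁ Mstar) (U : (bg9Y (Matrix (Fin N) (Fin N) ℂ) (specialUnitaryUnits (Fin N)) x).Cfg)
      (c : ↥(cubes x.toKIdx.D.toDomains)),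
      (𝔬 x).Gsq U c = gsqcoS x (trBasis N) (bg9Y (Matrix (Fin N) (Fin N) ℂ) (specialUnitaryUnits (Fin N)) x) (fun U => U) (parSymY x.toKIdx) c U)
    {M₁ a₁ c R : ℝ} {H : MemberY d ℓ hd hL b₀ b₁ Mstar → Prop}
    {P₁ P₂ P₃ P₄ P₄' P₅ P₆ P₇ P₈ : ∀ x : MemberY d ℓ hd hL b₀ b₁ Mstar, (bg9Y (Matrix (Fin N) (Fin N) ℂ) (specialUnitaryUnits (Fin N)) x).Cfg → Prop}
    (h36H : ∀ x : MemberY d ℓ hd hL b₀ b₁ Mstar, M₁ ≤ (geo9Y x).M → ∀ α₀ : ℝ, 0 < α₀ → c * (geo9Y x).M * α₀ ≤ a₁ →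
      ∀ U : (bg9Y (Matrix (Fin N) (Fin N) ℂ) (specialUnitaryUnits (Fin N)) x).Cfg, (bg9Y (Matrix (Fin N) (Fin N) ℂ) (specialUnitaryUnits (Fin N)) x).Reg335 c α₀ U →
        P₁ x U ∧ P₂ x U ∧ (P₃ x U ∧ P₄ x U ∧ P₄' x U) ∧ (P₅ x U ∧ P₆ x U) ∧ (P₇ x U ∧ P₈ x U)) :
    ∀ x : MemberY d ℓ hd hL b₀ b₁ Mstar, M₁ ≤ (geo9Y x).M → ∀ α₀ : ℝ, 0 < α₀ → c * (geo9Y x).M * α₀ ≤ a₁ →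
      ∀ U : (bg9Y (Matrix (Fin N) (Fin N) ℂ) (specialUnitaryUnits (Fin N)) x).Cfg, (bg9Y (Matrix (Fin N) (Fin N) ℂ) (specialUnitaryUnits (Fin N)) x).Reg335 c α₀ U →
        P₁ x U ∧ P₂ x U ∧ (P₃ x U ∧ (∀ q', IsTransposePair ((𝔬 x).Gsq U q') ((𝔬 x).Gsq U q')) ∧ P₄ x U ∧ P₄' x U ∧ DirTranspose37 (𝔬 x) (𝔡 x) U) ∧
          (P₅ x U ∧ P₆ x U ∧ DirSupHolder37 (𝔬 x) (𝔡 x) (𝔭 x) R (H x) U) ∧ (P₇ x U ∧ P₈ x U ∧ DirSup37 (𝔬 x) (𝔡 x) R (H x) U) :=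
  fun x hM α₀ hα₀ ha U hU => by
  obtain ⟨h₁, h₂, ⟨h₃, h₄, h₄'⟩, ⟨h₅, h₆⟩, ⟨h₇, h₈⟩⟩ := h36H x hM α₀ hα₀ ha U hU
  have hT : ∀ q', IsTransposePair ((𝔬 x).Gsq U q') ((𝔬 x).Gsq U q') := fun q' => by
    rw [hGsqF x U q']
    exact isTransposePair_GcoS_trBasis x.toKIdx (bg9Y (Matrix (Fin N) (Fin N) ℂ) (specialUnitaryUnits (Fin N)) x) (fun U => U)
      (GsqY x.toKIdx (parSymY x.toKIdx) (cubeDomY x q')) U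
      (isSymmTr_GsqY_parSymY x.toKIdx specialUnitaryUnits_le_unitaryUnits hU.1.1 (cubeDomY x q'))
  exact ⟨h₁, h₂, ⟨h₃, hT, h₄, h₄', dirTranspose37_memberY x (𝔬 x) (𝔡 x) U hU (h𝔡d x U) (h𝔡s x U)⟩,
    ⟨h₅, h₆, dirSupHolder37_pinsSA x (𝔬 x) (𝔡 x) (𝔭 x) (Gp x) (parS x) (h𝔭 x) (hblkS x) (hGpS x U) (hDS x U) (h𝔡d x U)⟩,
    ⟨h₇, h₈, dirSup37_pins x (𝔬 x) (𝔡 x) (Gp x) (hblkS x) (hblkYS x) (hGpS x U) (hDS x U) (hDsS x U) (h𝔡d x U) (h𝔡s x U)⟩⟩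

end Summit.QuantumFields.YangMills.BalabanUVNodes.N06DirKinematics3AtPins

end
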